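import Literature.Topology.FourManifolds.SurfaceGroupNotProjective
import Mathlib.Topology.Algebra.Category.ProfiniteGrp.Completion
import Mathlib.GroupTheory.Archimedean
import Mathlib.Data.ZMod.QuotientGroup
import HarnessLib

/-!
# Plumbing for "`Δ_Θ ≅ Ẑ(1)`" ([EtTh] §1 p. 12): the levels of `Ẑ = completion ℤ` and the finite
# Heisenberg test groups `H(ℤ/n)` (proof-only, generic; no definition)

Mochizuki, *The étale theta function …*, Publ. RIMS **45** (2009) [EtTh], §1 PRIMS PDF p. 12
("`∧² Δ^ell_X (≅ Ẑ(1))`") and §2 p. 45 ("the well-known structure of the theta-group")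
[cite: MochizukiEtTh2009, §1 p.12]. Layer L2 of the abc-iut cell, seat abc-iut-w5-d171; generic lemmas
used by `Discharge/Sec1FreeTwoHeisenbergZHat.lean` (GAP-LEDGER G-w4d021-1, part (C)).

* `ZHatLevels.exists_eq_zpowers` — a finite-index subgroup of `ℤ` is `nℤ` with `n ≥ 1`;
* `ZHatLevels.apply_pow_eq_zpow` — a continuous homomorphism `Ẑ → P → Q` to a DISCRETE group with
  `η(m) ↦ z^m` evaluates at `t ∈ Ẑ` to `z^(t mod n)` when `z^n = 1` (density of `η(ℤ)` in `Ẑ`);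
* `ZHatLevels.val_eq_one_of_zpow_eq_one` — vanishing of the `nℤ`-component tested on an element of
  order `n`;
* `ZHatLevels.exists_classTwo_commutator_orderOf` — for every `n ≥ 1` a FINITE group of nilpotency
  class two (the Heisenberg group `H(ℤ/n)`, realised as the tree's `CocycleExtension` of `(ℤ/n)²` by
  `ℤ/n` with the biadditive cocycle `v₁ w₂`, exactly as in `Discharge/Sec2DeltaThetaTorsionFree.lean`)
  with two elements whose commutator has order exactly `n`.
All folklore; `Ẑ` is Mathlib's `ProfiniteGrp.ProfiniteCompletion.completion (GrpCat.of (Multiplicative ℤ))`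
(= the tree's `SemiGraphs.ZHat` = `IUT.HodgeTheaters.ZHat`). HONEST FRAMING: nothing here bears on
[IUTchIII] Cor. 3.12.
-/

noncomputable section

namespace Literature.AnabelianGeometry.EtaleTheta

open Literature.Algebra.Homology Literature.Topology.FourManifolds
open _root_.Topology
open scoped commutatorElement
open CategoryTheory groupCohomology ProfiniteGrp ProfiniteGrp.ProfiniteCompletion

namespace ZHatLevels

/-- A finite-index subgroup of `Multiplicative ℤ` is `⟨n⟩` for some integer `n ≥ 1`. (Folklore plumbing
for "`≅ Ẑ(1)`".) [cite: MochizukiEtTh2009, §1 p.12] -/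
theorem exists_eq_zpowers (N : Subgroup (Multiplicative ℤ)) [hN : N.FiniteIndex] :
    ∃ n : ℕ, 0 < n ∧ N = Subgroup.zpowers (Multiplicative.ofAdd (n : ℤ)) := by
  obtain ⟨a, ha⟩ := Int.subgroup_cyclic (Subgroup.toAddSubgroup' N)
  have hNa : N = Subgroup.zpowers (Multiplicative.ofAdd a) := by
    ext x
    have h := congrArg (fun H : AddSubgroup ℤ => Multiplicative.toAdd x ∈ H) ha
    simp only [Subgroup.mem_toAddSubgroup', ofAdd_toAdd, eq_iff_iff] at h
    rw [h, AddSubgroup.mem_closure_singleton, Subgroup.mem_zpowers_iff]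
    constructor
    · rintro ⟨k, hk⟩
      exact ⟨k, by rw [← ofAdd_zsmul, hk, ofAdd_toAdd]⟩
    · rintro ⟨k, hk⟩
      exact ⟨k, by rw [← hk, ← ofAdd_zsmul, toAdd_ofAdd]⟩
  refine ⟨a.natAbs, ?_, ?_⟩
  · rcases Nat.eq_zero_or_pos a.natAbs with h0 | hpos
    · exfalso
      have ha0 : a = 0 := Int.natAbs_eq_zero.mp h0
      rw [ha0, ofAdd_zero, Subgroup.zpowers_one_eq_bot] at hNa
      have hidx := hN.index_ne_zero
      rw [hNa, Subgroup.index_bot, Nat.card_eq_zero_of_infinite] at hidx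
      exact hidx rfl
    · exact hpos
  · rw [hNa]
    rcases Int.natAbs_eq a with h | h
    · rw [← h]
    · conv_lhs => rw [h]
      rw [ofAdd_neg, Subgroup.zpowers_inv]

/-- Membership in `⟨n⟩ ≤ Multiplicative ℤ` is divisibility. (Folklore plumbing
for "`≅ Ẑ(1)`".) [cite: MochizukiEtTh2009, §1 p.12] -/
theorem ofAdd_mem_zpowers_iff (n : ℕ) (m : ℤ) :
    Multiplicative.ofAdd m ∈ Subgroup.zpowers (Multiplicative.ofAdd (n : ℤ)) ↔ (n : ℤ) ∣ m := by
  rw [Subgroup.mem_zpowers_iff]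
  constructor
  · rintro ⟨k, hk⟩
    rw [← ofAdd_zsmul, smul_eq_mul] at hk
    exact ⟨k, by rw [mul_comm]; exact (Multiplicative.ofAdd.injective hk).symm⟩
  · rintro ⟨k, rfl⟩
    exact ⟨k, by rw [← ofAdd_zsmul, smul_eq_mul, mul_comm]⟩

/-- Components of `η m ∈ Ẑ` are the classes of `m`. (Folklore plumbing
for "`≅ Ẑ(1)`".) [cite: MochizukiEtTh2009, §1 p.12] -/
theorem val_etaFn (m : Multiplicative ℤ) (N : FiniteIndexNormalSubgroup (Multiplicative ℤ)) :
    (etaFn (GrpCat.of (Multiplicative ℤ)) m).val N = (QuotientGroup.mk m : _ ⧸ N.toSubgroup) := rfl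

/-- **Evaluation of a continuous homomorphism on `Ẑ`-powers.**  If `pow : Ẑ → P` and `f : P → Q` are
continuous homomorphisms, `Q` discrete, with `f (pow (η m)) = z ^ m` for all integers `m` and
`z ^ n = 1`, then `f (pow t) = z ^ g` whenever the `⟨n⟩`-component of `t ∈ Ẑ` is the class of `g`
(density of `η(ℤ)` in `Ẑ`). (Folklore plumbing
for "`≅ Ẑ(1)`".) [cite: MochizukiEtTh2009, §1 p.12] -/
theorem apply_pow_eq_zpow {P Q : Type*} [Group P] [TopologicalSpace P] [Group Q]
    [TopologicalSpace Q] [DiscreteTopology Q]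
    (pow : completion (GrpCat.of (Multiplicative ℤ)) →ₜ* P) (f : P →ₜ* Q) (z : Q) {n : ℕ}
    (hzn : z ^ n = 1) (N : FiniteIndexNormalSubgroup (Multiplicative ℤ))
    (hN : (N.toSubgroup : Subgroup (Multiplicative ℤ)) = Subgroup.zpowers (Multiplicative.ofAdd (n : ℤ)))
    (hpow : ∀ m : ℤ, f (pow (etaFn (GrpCat.of (Multiplicative ℤ)) (Multiplicative.ofAdd m))) = z ^ m)
    (t : completion (GrpCat.of (Multiplicative ℤ))) {g : ℤ}
    (hg : t.val N = (QuotientGroup.mk (Multiplicative.ofAdd g) : _ ⧸ N.toSubgroup)) :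
    f (pow t) = z ^ g := by
  have hker : N.toSubgroup ≤ (zpowersHom Q z).ker := by
    intro x hx
    rw [hN] at hx
    obtain ⟨k, rfl⟩ := Subgroup.mem_zpowers_iff.mp hx
    rw [MonoidHom.mem_ker, ← ofAdd_zsmul, smul_eq_mul, zpowersHom_apply, toAdd_ofAdd, mul_comm,
      zpow_mul, zpow_natCast, hzn, one_zpow]
  let χ : Multiplicative ℤ ⧸ N.toSubgroup →* Q := QuotientGroup.lift N.toSubgroup (zpowersHom Q z) hker
  have hχ : ∀ m : ℤ, χ (QuotientGroup.mk (Multiplicative.ofAdd m)) = z ^ m := fun m => by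
    simp only [χ, QuotientGroup.lift_mk, zpowersHom_apply, toAdd_ofAdd]
  haveI : DiscreteTopology ((diagram (GrpCat.of (Multiplicative ℤ))).obj N) := ⟨rfl⟩
  have key : (fun s : completion (GrpCat.of (Multiplicative ℤ)) => f (pow s)) =
      fun s => χ (s.val N) := by
    refine (denseRange (G := GrpCat.of (Multiplicative ℤ))).equalizer
      (f.continuous_toFun.comp pow.continuous_toFun) ?_ ?_
    · have hproj : Continuous (fun s : completion (GrpCat.of (Multiplicative ℤ)) =>
          (s.val N : (diagram (GrpCat.of (Multiplicative ℤ))).obj N)) :=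
        (continuous_apply N).comp continuous_subtype_val
      exact continuous_of_discreteTopology.comp hproj
    · funext m
      change f (pow (etaFn _ m)) = χ (QuotientGroup.mk m)
      exact (hpow (Multiplicative.toAdd m)).trans (hχ (Multiplicative.toAdd m)).symm
  have key' : f (pow t) = χ (t.val N) := congrFun key t
  rw [key', hg]
  exact hχ g

/-- If the `⟨n⟩`-component of `t ∈ Ẑ` is the class of `g` and `z ^ g = 1` for an element `z` of order
`n`, then that component is trivial. (Folklore plumbing
for "`≅ Ẑ(1)`".) [cite: MochizukiEtTh2009, §1 p.12] -/
theorem val_eq_one_of_zpow_eq_one {Q : Type*} [Group Q] (z : Q) {n : ℕ} (hz : orderOf z = n)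
    (N : FiniteIndexNormalSubgroup (Multiplicative ℤ))
    (hN : (N.toSubgroup : Subgroup (Multiplicative ℤ)) = Subgroup.zpowers (Multiplicative.ofAdd (n : ℤ)))
    (t : completion (GrpCat.of (Multiplicative ℤ))) {g : ℤ}
    (hg : t.val N = (QuotientGroup.mk (Multiplicative.ofAdd g) : _ ⧸ N.toSubgroup)) (hzg : z ^ g = 1) :
    t.val N = 1 := by
  rw [hg]
  change (QuotientGroup.mk (Multiplicative.ofAdd g) : Multiplicative ℤ ⧸ N.toSubgroup) = 1
  rw [QuotientGroup.eq_one_iff, hN, ofAdd_mem_zpowers_iff, ← hz]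
  exact orderOf_dvd_iff_zpow_eq_one.mpr hzg


/-- **The finite Heisenberg test group of level `n`** ("the well-known structure of the theta-group",
[EtTh] p. 45; here: the cocycle extension of `(ℤ/n)²` by `ℤ/n` with cocycle `B(v, w) = v₁ w₂`): a finite
group of nilpotency class two with two elements `x, y` whose commutator has order exactly `n`.
[cite: MochizukiEtTh2009, Prop 2.12 p.45] -/
theorem exists_classTwo_commutator_orderOf (n : ℕ) [NeZero n] :
    ∃ (H : Type) (_ : Group H) (_ : Finite H) (x y : H),
      orderOf (⁅x, y⁆ : H) = n ∧
      ∀ q ∈ (⁅⁅(⊤ : Subgroup H), (⊤ : Subgroup H)⁆, (⊤ : Subgroup H)⁆ : Subgroup H), q = 1 := by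
  let B : (ZMod n × ZMod n) →+ (ZMod n × ZMod n) →+ ZMod n :=
    { toFun := fun v =>
        { toFun := fun w => v.1 * w.2
          map_zero' := by simp
          map_add' := fun w w' => by simp only [Prod.snd_add, mul_add] }
      map_zero' := AddMonoidHom.ext fun w => by simp
      map_add' := fun v v' => AddMonoidHom.ext fun w => by
        simp only [AddMonoidHom.coe_mk, ZeroHom.coe_mk, AddMonoidHom.add_apply, Prod.fst_add,
          add_mul] }
  obtain ⟨f, hf⟩ := exists_cocycles₂_of_biadditive B
  haveI : Finite (Rep.trivial (ZMod n) (Multiplicative (ZMod n × ZMod n)) (ZMod n)) :=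
    inferInstanceAs (Finite (ZMod n))
  let x : CocycleExtension f := ⟨0, Multiplicative.ofAdd (1, 0)⟩
  let y : CocycleExtension f := ⟨0, Multiplicative.ofAdd (0, 1)⟩
  -- commutators in `E_f` are central, and `[x, y]` has order `n`
  have hQ1 : ∀ q ∈ (⁅(⊤ : Subgroup (CocycleExtension f)), (⊤ : Subgroup (CocycleExtension f))⁆ :
      Subgroup (CocycleExtension f)), ∃ c₀, q = CocycleExtension.inl f c₀ := by
    intro q hq
    have hle : (⁅(⊤ : Subgroup (CocycleExtension f)), (⊤ : Subgroup (CocycleExtension f))⁆ :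
        Subgroup (CocycleExtension f)) ≤ (CocycleExtension.rightHom f).ker := by
      rw [← commutator_def]
      exact Abelianization.commutator_subset_ker _
    have hq' := hle hq
    rw [← CocycleExtension.range_inl_eq_ker_rightHom] at hq'
    obtain ⟨c₀, hc₀⟩ := hq'
    exact ⟨c₀, hc₀.symm⟩
  have hcentral : ∀ (c₀) (q : CocycleExtension f), Commute (CocycleExtension.inl f c₀) q := by
    intro c₀ q
    have h := CocycleExtension.mul_inl_mul_inv f q c₀.toAdd
    rw [Rep.trivial_ρ_apply, ofAdd_toAdd] at h
    exact (mul_inv_eq_iff_eq_mul.mp h).symm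
  have hQ3 : ∀ q ∈ (⁅⁅(⊤ : Subgroup (CocycleExtension f)), (⊤ : Subgroup (CocycleExtension f))⁆,
      (⊤ : Subgroup (CocycleExtension f))⁆ : Subgroup (CocycleExtension f)), q = 1 := by
    have hle : (⁅⁅(⊤ : Subgroup (CocycleExtension f)), (⊤ : Subgroup (CocycleExtension f))⁆,
        (⊤ : Subgroup (CocycleExtension f))⁆ : Subgroup (CocycleExtension f)) ≤ ⊥ := by
      refine Subgroup.commutator_le.mpr fun c₀ hc₀ q _ => ?_
      obtain ⟨c₁, rfl⟩ := hQ1 c₀ hc₀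
      rw [Subgroup.mem_bot, commutatorElement_eq_one_iff_commute]
      exact hcentral c₁ q
    exact fun q hq => (Subgroup.mem_bot).mp (hle hq)
  have horder : orderOf (⁅x, y⁆ : CocycleExtension f) = n := by
    rw [commutatorElement_def,
      CocycleExtension.commutator_eq_inl_of_trivial f _ _ (Commute.all _ _), hf, hf]
    simp only [x, y, toAdd_ofAdd, B, AddMonoidHom.coe_mk, ZeroHom.coe_mk, mul_one, mul_zero, sub_zero]
    rw [orderOf_injective _ (CocycleExtension.inl_injective f), orderOf_ofAdd_eq_addOrderOf,
      ZMod.addOrderOf_one]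
  exact ⟨CocycleExtension f, inferInstance, inferInstance, x, y, horder, hQ3⟩

end ZHatLevels

end Literature.AnabelianGeometry.EtaleTheta

end
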